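import Summits.BirchSwinnertonDyer.BirchSwinnertonDyer.Theses.ResidualThetaTransportAtTwo
import Summits.BirchSwinnertonDyer.BirchSwinnertonDyer.Theorems.ResidualThetaTransportAtTwoThetaLayerLambdaCongruenceAtTwoDepletionInjective
import Summits.BirchSwinnertonDyer.BirchSwinnertonDyer.Theorems.ResidualThetaTransportAtTwoThetaLayerLambdaCongruenceAtTwoResidualReduction
import HarnessLib

/-!
# Crux `ThetaLayerLambdaCongruenceAtTwo` (stmt-BirchSwinnertonDyer-20688, route ResidualThetaTransportAtTwo), line
# `birth`, skeleton v8: the SPLIT GLUE — the crux BY NAME from the three registered stubs (C3k) + (μ-W₁) + (NR-g)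
# (lead prover bsd-wall-rtt-p3 g3; `--supports stmt-BirchSwinnertonDyer-20688 --as helper`; closes nothing)

HONEST FRAMING. ONE THEOREM, a composition of LANDED glue; its three hypotheses are the three registered stubs of
skeleton v8 (`Cruxes/ThetaLayerLambdaCongruenceAtTwo/Lines/birth.lean`, sha16 `0095a66eb2110702`) VERBATIM, its
conclusion is the crux by name. Nothing about any curve or form is asserted; (μ-W₁) is conjecture-grade (`μ = 0`-type
for `W` at `2`), (C3k) is known mathematics not yet formalised, (NR-g) is in print; BSD is not proved by any of this.
This is the certificate a planner needs to SPLIT item 20688 into three children with texts = the hypotheses below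
(director-bsd W-65 (b): «C3 enters only as split children, glue proved first»).

Composition: `plusLineAtTwo_of_charTwo` (`…ResidualReduction`, lead g3: (C3k) ⟹ (C3)) then
`thetaLayerLambdaCongruenceAtTwo_of_plusLine_curveMax_nonRoot` (`…DepletionInjective`, width seat w3 g2:
(C3) + (μ-W₁) + (NR-g) ⟹ crux, over `…RescaledPlusLine`, `…PlusLineGlue`, `…SymbolOneLayer`, `…SymbolStubs`, …).

References: [GreenbergVatsal2000] §1 (10), §3; [Vatsal1999] (1.10); [RibetStein2011] Def. 3.3, Thm. 3.5, Prop. 3.7;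
[Deligne1974] Thm. 8.2; [AtkinLehner1970] Thm. 3.
-/

noncomputable section

-- justification: the `Summit.BirchSwinnertonDyer.BirchSwinnertonDyer.…` path repeats a component (route-file convention)
set_option linter.dupNamespace false

open scoped Classical MatrixGroups

open Literature.NumberTheory.EllipticCurves Literature.NumberTheory.EllipticCurves.ModularForms

namespace Summit.BirchSwinnertonDyer.BirchSwinnertonDyer.Theorems.ThetaLayerLambdaCongruenceAtTwo

/-- **SPLIT GLUE for crux 20688 (skeleton v8)**: `ThetaLayerLambdaCongruenceAtTwo` BY NAME from
(C3k) «plus multiplicity one for Γ₀(N')-symbol functions over fields of characteristic 2» (`hC3k`, = registered stub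
`stub_plusLineCharTwo`), (μ-W₁) «the curve's `S₀`-depleted rational plus symbol attains its `2`-adic maximum over
`ℚ` at a `2`-power cusp of some even layer» (`hμW`, = `stub_curveDepletedSymbolMaxAtTwoPowerCusp`) and (NR-g) «no
reciprocal root of an Euler factor of the partner is `ℓ`·(root of unity)» (`hNR`, = `stub_partnerEulerFactorNonRoot`).
[cite: GreenbergVatsal2000, §1 (10) and §3 (shape; the inputs are hypotheses)] -/
theorem thetaLayerLambdaCongruenceAtTwo_of_charTwo_curveMax_nonRoot
    (hC3k : ∀ (W : WeierstrassCurve ℚ) [W.IsElliptic] [W.IsGloballyMinimal], Literature.NumberTheory.EllipticCurves.Rank1Residual.GoodSS W 2 → W.Δ < 0 → ∀ (N' : ℕ), Odd N' → (∀ ℓ : ℕ, ℓ.Prime → ℓ ∣ W.conductorNorm ℤ → ℓ ∣ N') → ∀ (k : Type) [Field k] [CharP k 2] (Ψ₁ Ψ₂ : ℚ → k), (∀ (r : ℚ) (z : ℤ), Ψ₁ (r + z) = Ψ₁ r) → (∀ r : ℚ, Ψ₁ (-r) = Ψ₁ r) → (∀ (γ : CongruenceSubgroup.Gamma0 (N'))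 (r : ℚ), ((γ : SL(2, ℤ)) 1 0 : ℚ) * r + ((γ : SL(2, ℤ)) 1 1 : ℚ) ≠ 0 → Ψ₁ ((((γ : SL(2, ℤ)) 0 0 : ℚ) * r + ((γ : SL(2, ℤ)) 0 1 : ℚ)) / (((γ : SL(2, ℤ)) 1 0 : ℚ) * r + ((γ : SL(2, ℤ)) 1 1 : ℚ))) = (if ((γ : SL(2, ℤ)) 1 0) = 0 then 0 else Ψ₁ ((((γ : SL(2, ℤ)) 0 0 : ℚ)) / (((γ : SL(2, ℤ)) 1 0 : ℚ)))) + Ψ₁ r) → (∀ (r : ℚ) (z : ℤ), Ψ₂ (r + z) = Ψ₂ r) → (∀ r : ℚ, Ψ₂ (-r) = Ψ₂ r) → (∀ (γ : CongruenceSubgroup.Gamma0 (N')) (r : ℚ), ((γ : SL(2, ℤ)) 1 0 : ℚ) * r + ((γ : SL(2, ℤ)) 1 1 : ℚ) ≠ 0 → Ψ₂ ((((γ : SL(2, ℤ)) 0 0 : ℚ) * r + ((γ : SL(2, ℤ)) 0 1 : ℚ)) / (((γ : SL(2, ℤ)) 1 0 : ℚ) * r + ((γ : SL(2, ℤ)) 1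 1 : ℚ))) = (if ((γ : SL(2, ℤ)) 1 0) = 0 then 0 else Ψ₂ ((((γ : SL(2, ℤ)) 0 0 : ℚ)) / (((γ : SL(2, ℤ)) 1 0 : ℚ)))) + Ψ₂ r) → (∃ r : ℚ, Ψ₁ r ≠ 0) → (∃ r : ℚ, Ψ₂ r ≠ 0) → (∀ q : ℕ, q.Prime → ¬ q ∣ N' → ∀ r : ℚ, (∑ j : Fin q, Ψ₁ ((r + j) / q)) + Ψ₁ (q * r) = (W.LFunction q : k) * Ψ₁ r) → (∀ q : ℕ, q.Prime → ¬ q ∣ N' → ∀ r : ℚ, (∑ j : Fin q, Ψ₂ ((r + j) / q)) + Ψ₂ (q * r) = (W.LFunction q : k) * Ψ₂ r) → (∀ ℓ : ℕ, ℓ.Prime → ℓ ∣ N' → ∀ r : ℚ, ∑ j : Fin ℓ, Ψ₁ ((r + j) / ℓ) = 0) → (∀ ℓ : ℕ, ℓ.Prime → ℓ ∣ N' → ∀ r : ℚ, ∑ j : Fin ℓ, Ψ₂ ((r + j) / ℓ) = 0) → ∃ c : k, ∀ r : ℚ, Ψ₂ r = c * Ψ₁ r)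
    (hμW : ∀ (W : WeierstrassCurve ℚ) [W.IsElliptic] [W.IsGloballyMinimal], ¬ W.HasCM → W.analyticRank = 0 → Literature.NumberTheory.EllipticCurves.Rank1Residual.GoodSS W 2 → W.frobeniusTrace 2 = 0 → W.Δ < 0 → ∀ [NeZero (W.conductorNorm ℤ)] (f : CuspForm (CongruenceSubgroup.Gamma0 (W.conductorNorm ℤ)) 2), Literature.NumberTheory.EllipticCurves.ModularForms.IsNewformOf W f → ∀ (S₀ : Finset (IsDedekindDomain.HeightOneSpectrum (NumberField.RingOfIntegers ℚ))), (∀ v ∈ S₀, ((2 : ℕ) : NumberField.RingOfIntegers ℚ) ∉ v.asIdeal) → (∀ v : IsDedekindDomain.HeightOneSpectrum (NumberField.RingOfIntegers ℚ), ¬ W.HasGoodReductionAt v → v ∈ S₀) → ∃ n₁ : ℕ, Even n₁ ∧ ∃ s : ZMod (2 ^ n₁), ∀ r : ℚ, ‖(∑ k ∈ Fintype.piFinset (fun _ : S₀ ↦ Finset.range 3), (∏ v : S₀, ((W.localPolynomialAt (v : IsDedekindDomain.HeightOneSpectrum (NumberField.RingOfIntegers ℚ))).map (Int.castRingHom (PadicAlgCl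 2))).coeff (k v) * ((Rat.HeightOneSpectrum.natGenerator (v : IsDedekindDomain.HeightOneSpectrum (NumberField.RingOfIntegers ℚ)) : PadicAlgCl 2)⁻¹) ^ (k v)) * algebraMap ℚ (PadicAlgCl 2) (ratPlusSymbol f (r * ((∏ v : S₀, Rat.HeightOneSpectrum.natGenerator (v : IsDedekindDomain.HeightOneSpectrum (NumberField.RingOfIntegers ℚ)) ^ (k v) : ℕ) : ℚ))))‖ ≤ ‖(∑ k ∈ Fintype.piFinset (fun _ : S₀ ↦ Finset.range 3), (∏ v : S₀, ((W.localPolynomialAt (v : IsDedekindDomain.HeightOneSpectrum (NumberField.RingOfIntegers ℚ))).map (Int.castRingHom (PadicAlgCl 2))).coeff (k v) * ((Rat.HeightOneSpectrum.natGenerator (v : IsDedekindDomain.HeightOneSpectrum (NumberField.RingOfIntegers ℚ)) : PadicAlgCl 2)⁻¹) ^ (k v)) * algebraMap ℚ (PadicAlgCl 2) (ratPlusSymbol f ((((((Literature.NumberTheory.EllipticCurves.cyclotomicGenerator 2 : ZMod (2 ^ (n₁ + 2))) ^ s.val).val : ℚ) / (2 : ℚ) ^ (n₁ + 2))) * ((∏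 v : S₀, Rat.HeightOneSpectrum.natGenerator (v : IsDedekindDomain.HeightOneSpectrum (NumberField.RingOfIntegers ℚ)) ^ (k v) : ℕ) : ℚ))))‖)
    (hNR : ∀ (M : ℕ) [NeZero M] (g : CuspForm (CongruenceSubgroup.Gamma0 M) 2) (ι : Literature.NumberTheory.EllipticCurves.ModularForms.coeffField g →+* PadicAlgCl 2), Literature.NumberTheory.EllipticCurves.ModularForms.IsNewform0 g → ∀ ℓ : ℕ, ℓ.Prime → ∀ ζ : PadicAlgCl 2, (∃ m : ℕ, 0 < m ∧ ζ ^ m = 1) → Polynomial.eval (ζ * ((ℓ : PadicAlgCl 2))⁻¹) (1 - Polynomial.C (embCoeff g ι ℓ) * Polynomial.X + (if ℓ ∣ M then 0 else Polynomial.C (ℓ : PadicAlgCl 2)) * Polynomial.X ^ 2 : Polynomial (PadicAlgCl 2)) ≠ 0) :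
    Summit.BirchSwinnertonDyer.BirchSwinnertonDyer.Theses.ResidualThetaTransportAtTwo.ThetaLayerLambdaCongruenceAtTwo :=
  thetaLayerLambdaCongruenceAtTwo_of_plusLine_curveMax_nonRoot (plusLineAtTwo_of_charTwo hC3k) hμW hNR

end Summit.BirchSwinnertonDyer.BirchSwinnertonDyer.Theorems.ThetaLayerLambdaCongruenceAtTwo

end
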